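import Mathlib
import HarnessLib
import Summits.NavierStokesRegularity.NavierStokesRegularity.Theorems.TypeIQuarterGateScarEnvelopeTypeIForcedTsaiAlgL4

/-!
# ARM B lane E-exact, Type-I-tail class — a FAST value-preserving product for the 5-monomial list algebra and the
  exact `L⁴` norm of LARGE witness fields (`AlgRow.l4CheckFast`; ns-wall-extremal, cert hand ns-crc-p2 g7, 2026-08-29)

`…ForcedTsaiAlgL4` computes `∫_{ℝ³} ‖U‖⁴ = c₁π + c₂π²` exactly (`AlgRow.l4`) but forms `‖U‖²·‖U‖²` with the flat list product
`Poly5.nmul` (`|‖U‖²|²` monomials appended, then one `mergeSort`, then `combine`).  For the registered larger-basis vectors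
(946 input monomials; `‖U‖²` has 3 198 distinct monomials) that is a 10.2 M-element list with `ℚ` gcds — beyond the gate's
elaboration budget.  This module supplies the same VALUE by a cheaper route and proves it:
* `Poly5.mergeAdd` — tail-recursive merge of two monomial lists ADDING the coefficients of equal keys (value-preserving for ANY
  inputs, `Poly5.eval_mergeAdd`; on key-sorted inputs it keeps the lists sorted and combined — efficiency only, never used in a proof);
* `Poly5.mulFast P Q` — depth-first divide-and-conquer over `P` (`Poly5.mulDC`), merging the half-products with `mergeAdd`
  (`Poly5.eval_mulFast : eval (mulFast P Q) = eval P · eval Q`); only `O(log |P|)` partial products are alive at once and the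
  like terms are combined early (measured on the mirror for the level-16 vector: 14.8 M merge steps, 38 209 surviving monomials);
* `AlgRow.l4Fast` / `AlgRow.l4CheckFast K` — `‖U‖²` is normalised and pre-scaled by a common denominator `D` (`Poly5.commonDen`,
  so every coefficient product is an integer product), `∫ (D‖U‖²)² = c₁π + c₂π²` by the landed moment table `Poly5.integrate`,
  and the check is `encHi (c₁,c₂) ≤ K·D²`;
* `AlgRow.l4Fast_sound : l4CheckFast K = true → Integrable ‖U‖⁴ ∧ ∫‖U‖⁴ ≤ K` (from `integral_poly5`, `norm_field_pow_four`).
Self-test (kernel, `native_decide`, small row): `l4Fast` and `l4` agree exactly after the `D²` rescaling.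
Portrait information about explicit near-profile fields (their size in Tsai's class `L^q`, `3 < q < ∞`); UPPER-bound/existence lane;
excludes nothing; nothing here bears on Navier–Stokes regularity; 23843 / H3 OPEN.
-/

set_option linter.dupNamespace false

namespace Summit.NavierStokesRegularity.NavierStokesRegularity.Cruxes.ScarEnvelopeTypeI.ForcedTsai

open MeasureTheory Set Metric Real Finset
open scoped RealInnerProductSpace ContDiff
open Literature.Analysis.FluidPDE

/-! ## The fast list algebra -/

namespace Poly5

/-- Tail-recursive merge of two monomial lists that ADDS the coefficients of monomials with equal keys (a zero sum is dropped);
`acc` is the already merged prefix in reverse.  Value-preserving for any inputs; for key-sorted, combined inputs the output is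
key-sorted and combined (efficiency only). -/
def mergeAddGo : Poly5 → Poly5 → Poly5 → Poly5
  | [], Q, acc => acc.reverseAux Q
  | m :: P, [], acc => acc.reverseAux (m :: P)
  | m :: P, m' :: Q, acc =>
    if m.key = m'.key then
      (if m.c + m'.c = 0 then mergeAddGo P Q acc else mergeAddGo P Q ({ m with c := m.c + m'.c } :: acc))
    else if keyLE m m' then mergeAddGo P (m' :: Q) (m :: acc)
    else mergeAddGo (m :: P) Q (m' :: acc)
  termination_by P Q _ => P.length + Q.length

/-- Merge-with-combine of two monomial lists (`mergeAddGo` from an empty accumulator). -/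
def mergeAdd (P Q : Poly5) : Poly5 := mergeAddGo P Q []

/-- Depth-first divide-and-conquer product `P · Q`: halve `P`, multiply the halves recursively, `mergeAdd` the two half-products
(`fuel` = recursion budget; the fuel-`0` fallback is a value-preserving sequential fold). -/
def mulDC (Q : Poly5) : ℕ → Poly5 → Poly5
  | 0, P => P.foldl (fun acc m => mergeAdd acc (Q.map (Mono5.mul m))) []
  | _ + 1, [] => []
  | _ + 1, [m] => Q.map (Mono5.mul m)
  | fuel + 1, m :: m' :: P =>
    mergeAdd (mulDC Q fuel ((m :: m' :: P).take ((P.length + 2) / 2)))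
      (mulDC Q fuel ((m :: m' :: P).drop ((P.length + 2) / 2)))

/-- Fast combining product (same VALUE as `mul` / `nmul`, see `eval_mulFast`). -/
def mulFast (P Q : Poly5) : Poly5 := mulDC Q P.length P

/-- A common denominator of the coefficients of a monomial list (efficiency device only: after scaling by it the coefficients are
integers and the `ℚ` products in `mulFast` carry no gcd work). -/
def commonDen (P : Poly5) : ℕ := P.foldl (fun d m => Nat.lcm d m.c.den) 1

/-! ### Value lemmas -/

/-- `reverseAux` keeps the total value. -/
theorem eval_reverseAux (τ : ℝ) (acc L : Poly5) (y : E3) :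
    Poly5.eval τ (acc.reverseAux L) y = Poly5.eval τ acc y + Poly5.eval τ L y := by
  rw [List.reverseAux_eq, Poly5.eval_append, Poly5.eval_perm τ (List.reverse_perm acc)]

/-- `mergeAddGo` keeps the total value. -/
theorem eval_mergeAddGo (τ : ℝ) (y : E3) : ∀ (n : ℕ) (P Q acc : Poly5), P.length + Q.length ≤ n →
    Poly5.eval τ (mergeAddGo P Q acc) y = Poly5.eval τ P y + Poly5.eval τ Q y + Poly5.eval τ acc y := by
  intro n
  induction n with
  | zero =>
    intro P Q acc hlen
    have hP : P = [] := List.eq_nil_of_length_eq_zero (by omega)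
    have hQ : Q = [] := List.eq_nil_of_length_eq_zero (by omega)
    subst hP; subst hQ
    rw [mergeAddGo, eval_reverseAux]; simp
  | succ n ih =>
    intro P Q acc hlen
    match P, Q with
    | [], Q =>
      rw [mergeAddGo, eval_reverseAux]; simp; ring
    | m :: P, [] =>
      rw [mergeAddGo, eval_reverseAux]; simp; ring
    | m :: P, m' :: Q =>
      simp only [List.length_cons] at hlen
      rw [mergeAddGo]
      by_cases hkey : m.key = m'.key
      · rw [if_pos hkey]
        have hsum := Mono5.eval_key_eq τ hkey y
        by_cases hc : m.c + m'.c = 0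
        · rw [if_pos hc, ih P Q acc (by omega)]
          have h0 : Mono5.eval τ { m with c := m.c + m'.c } y = 0 := by simp [Mono5.eval, hc]
          simp only [Poly5.eval_cons]
          linarith
        · rw [if_neg hc, ih P Q _ (by omega)]
          simp only [Poly5.eval_cons]
          linarith
      · rw [if_neg hkey]
        by_cases hle : keyLE m m' = true
        · rw [if_pos hle, ih P (m' :: Q) (m :: acc) (by simp; omega)]
          simp only [Poly5.eval_cons]; ring
        · rw [if_neg hle, ih (m :: P) Q (m' :: acc) (by simp; omega)]
          simp only [Poly5.eval_cons]; ring

/-- `mergeAdd` adds values. -/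
@[simp] theorem eval_mergeAdd (τ : ℝ) (P Q : Poly5) (y : E3) :
    Poly5.eval τ (mergeAdd P Q) y = Poly5.eval τ P y + Poly5.eval τ Q y := by
  rw [mergeAdd, eval_mergeAddGo τ y _ P Q [] le_rfl]; simp

/-- The sequential fallback multiplies values. -/
theorem eval_foldl_mergeAdd (τ : ℝ) (Q : Poly5) (y : E3) : ∀ (P acc : Poly5),
    Poly5.eval τ (P.foldl (fun acc m => mergeAdd acc (Q.map (Mono5.mul m))) acc) y =
      Poly5.eval τ acc y + Poly5.eval τ P y * Poly5.eval τ Q y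
  | [], acc => by simp
  | m :: P, acc => by
    rw [List.foldl_cons, eval_foldl_mergeAdd τ Q y P _, eval_mergeAdd, Poly5.eval_map_mul, Poly5.eval_cons]; ring

/-- `mulDC` multiplies values (any fuel). -/
theorem eval_mulDC (τ : ℝ) (Q : Poly5) (y : E3) : ∀ (fuel : ℕ) (P : Poly5),
    Poly5.eval τ (mulDC Q fuel P) y = Poly5.eval τ P y * Poly5.eval τ Q y
  | 0, P => by rw [mulDC, eval_foldl_mergeAdd]; simp
  | _ + 1, [] => by simp [mulDC]
  | _ + 1, [m] => by rw [mulDC, Poly5.eval_map_mul]; simp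
  | fuel + 1, m :: m' :: P => by
    rw [mulDC, eval_mergeAdd, eval_mulDC τ Q y fuel, eval_mulDC τ Q y fuel, ← add_mul, ← Poly5.eval_append,
      List.take_append_drop]

/-- **`mulFast` multiplies values.** -/
@[simp] theorem eval_mulFast (τ : ℝ) (P Q : Poly5) (y : E3) :
    Poly5.eval τ (mulFast P Q) y = Poly5.eval τ P y * Poly5.eval τ Q y := by
  rw [mulFast, eval_mulDC]

end Poly5

/-! ## The fast exact `L⁴` check of a row -/

namespace AlgRow

/-- Fast exact `∫‖U‖⁴`: with `V := norm (D • ‖U‖²)`, `D = commonDen ‖U‖²`, returns `(Poly5.integrate τ (mulFast V V), D)`, i.e.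
`∫ (D‖U‖²)² = c₁π + c₂π²` as `some (c₁, c₂)` (or `none` if a monomial diverges) together with the scaling `D`. -/
def l4Fast (r : AlgRow) : Option (ℚ × ℚ) × ℕ :=
  let U2 := r.u2Poly
  let D := Poly5.commonDen U2
  let V := Poly5.norm (Poly5.scale (D : ℚ) U2)
  (Poly5.integrate r.tau (Poly5.mulFast V V), D)

/-- The fast `L⁴` check: `0 < τ`, `0 < D`, and the certified upper enclosure of `∫ (D‖U‖²)²` is `≤ K · D²`. -/
def l4CheckFast (r : AlgRow) (K : ℚ) : Bool :=
  decide (0 < r.tau) &&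
    (match r.l4Fast with
      | (some c, D) => decide (0 < D) && decide (encHi c ≤ K * (D : ℚ) ^ 2)
      | (none, _) => false)

/-- **The exact `L⁴` bound, fast form**: a passing `l4CheckFast K` certifies `‖U‖⁴` integrable on `ℝ³` with `∫‖U‖⁴ ≤ K`
(`U = r.field`, the explicit witness field `curl Ψ` of the row). -/
theorem l4Fast_sound (r : AlgRow) (K : ℚ) (h : r.l4CheckFast K = true) :
    Integrable (fun y : E3 => ‖r.field y‖ ^ 4) ∧ ∫ y, ‖r.field y‖ ^ 4 ≤ (K : ℝ) := by
  unfold AlgRow.l4CheckFast at h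
  rcases hl : r.l4Fast with ⟨oc, D⟩
  rw [hl] at h
  rcases oc with _ | c
  · simp at h
  · simp only [Bool.and_eq_true, decide_eq_true_eq] at h
    obtain ⟨hτ, hD, hK⟩ := h
    simp only [AlgRow.l4Fast, Prod.mk.injEq] at hl
    obtain ⟨hint, hDdef⟩ := hl
    set Dn : ℕ := Poly5.commonDen r.u2Poly with hDn
    set V : Poly5 := Poly5.norm (Poly5.scale (Dn : ℚ) r.u2Poly) with hV
    obtain ⟨hI, hval⟩ := integral_poly5 hτ (Poly5.mulFast V V) hint
    have hτcast : ((r.tau : ℚ) : ℝ) = r.tauR := rfl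
    rw [hτcast] at hI hval
    have hDpos : (0 : ℝ) < (Dn : ℝ) := by rw [hDdef]; exact_mod_cast hD
    have hD2 : (0 : ℝ) < (Dn : ℝ) ^ 2 := by positivity
    have hpt : ∀ y : E3, Poly5.eval r.tauR (Poly5.mulFast V V) y = (Dn : ℝ) ^ 2 * ‖r.field y‖ ^ 4 := by
      intro y
      rw [r.norm_field_pow_four y, Poly5.eval_nmul, Poly5.eval_mulFast, hV, Poly5.eval_norm, Poly5.eval_scale]
      push_cast; ring
    have hfun : (fun y : E3 => ‖r.field y‖ ^ 4) =
        fun y => ((Dn : ℝ) ^ 2)⁻¹ * Poly5.eval r.tauR (Poly5.mulFast V V) y := by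
      funext y; rw [hpt]; field_simp
    rw [hfun]
    refine ⟨hI.const_mul _, ?_⟩
    rw [integral_const_mul, hval, inv_mul_le_iff₀ hD2]
    have hK' : ((encHi c : ℚ) : ℝ) ≤ (K : ℝ) * (Dn : ℝ) ^ 2 := by
      rw [hDdef]; exact_mod_cast hK
    calc (c.1 : ℝ) * π + (c.2 : ℝ) * π ^ 2 ≤ (encHi c : ℝ) := le_encHi c
      _ ≤ (K : ℝ) * (Dn : ℝ) ^ 2 := hK'
      _ = (Dn : ℝ) ^ 2 * (K : ℝ) := mul_comm _ _

end AlgRow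

/-! ## Kernel self-test (small row): the fast integrator agrees EXACTLY with the landed one after the `D²` rescaling -/

/-- A small test row: `Ψ = v · (ẑ × y)` at `τ = 3` (the `ℓ = 1` Type-I tail alone), no floor, unit radii, no claims. -/
def l4TestRow : AlgRow := ⟨3, ![[⟨0, 1, 0, 0, 1, -1⟩], [⟨1, 0, 0, 0, 1, 1⟩], []], 0, 0, 1, 1, 1, 0, 0⟩

example : l4TestRow.l4Fast.1 =
    (l4TestRow.l4.map fun c => (c.1 * (l4TestRow.l4Fast.2 : ℚ) ^ 2, c.2 * (l4TestRow.l4Fast.2 : ℚ) ^ 2)) := by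
  native_decide

example : l4TestRow.l4CheckFast (1757654 / 1000) = true ∧ l4TestRow.l4CheckFast (1757653 / 1000) = false := by
  native_decide

/-! ## Appendix (2026-08-29, idea-crit-7 g6 price L4-3 «portrait number = two-sided»): the EXACT value as a theorem

`l4Fast_sound` above only exports the corollary `∫‖U‖⁴ ≤ K`; the equality it passes through is exported here, so that a row file can
state `∫‖U‖⁴ = (c₁π + c₂π²)/D²` from ONE kernel replay `r.l4Fast = (some (c₁, c₂), D)` with literal integers. -/

/-- The common denominator is positive (it is an `lcm` chain started at `1` over positive denominators). -/
theorem Poly5.commonDen_pos (P : Poly5) : 0 < Poly5.commonDen P := by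
  unfold Poly5.commonDen
  suffices h : ∀ d : ℕ, 0 < d → 0 < P.foldl (fun d m => Nat.lcm d m.c.den) d from h 1 one_pos
  induction P with
  | nil => intro d hd; simpa using hd
  | cons m P ih => intro d hd; simp only [List.foldl_cons]; exact ih _ (Nat.lcm_pos hd m.c.den_pos)

/-- **The exact `L⁴` value, fast form**: if the kernel evaluates `r.l4Fast` to `(some (c₁, c₂), D)` (one `native_decide` replay per
row) and `0 < τ`, then `‖U‖⁴` is integrable on `ℝ³` and `∫‖U‖⁴ = (c₁π + c₂π²) / D²` EXACTLY (`U = r.field = curl Ψ`). -/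
theorem AlgRow.l4Fast_exact (r : AlgRow) (c₁ c₂ : ℚ) (D : ℕ) (h : r.l4Fast = (some (c₁, c₂), D)) (hτ : 0 < r.tau) :
    Integrable (fun y : E3 => ‖r.field y‖ ^ 4) ∧
      ∫ y, ‖r.field y‖ ^ 4 = ((c₁ : ℝ) * π + (c₂ : ℝ) * π ^ 2) / (D : ℝ) ^ 2 := by
  simp only [AlgRow.l4Fast, Prod.mk.injEq] at h
  obtain ⟨hint, hDdef⟩ := h
  set Dn : ℕ := Poly5.commonDen r.u2Poly with hDn
  set V : Poly5 := Poly5.norm (Poly5.scale (Dn : ℚ) r.u2Poly) with hV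
  obtain ⟨hI, hval⟩ := integral_poly5 hτ (Poly5.mulFast V V) hint
  have hτcast : ((r.tau : ℚ) : ℝ) = r.tauR := rfl
  rw [hτcast] at hI hval
  have hDpos : (0 : ℝ) < (Dn : ℝ) := by exact_mod_cast Poly5.commonDen_pos r.u2Poly
  have hD2 : (0 : ℝ) < (Dn : ℝ) ^ 2 := by positivity
  have hpt : ∀ y : E3, Poly5.eval r.tauR (Poly5.mulFast V V) y = (Dn : ℝ) ^ 2 * ‖r.field y‖ ^ 4 := by
    intro y
    rw [r.norm_field_pow_four y, Poly5.eval_nmul, Poly5.eval_mulFast, hV, Poly5.eval_norm, Poly5.eval_scale]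
    push_cast; ring
  have hfun : (fun y : E3 => ‖r.field y‖ ^ 4) =
      fun y => ((Dn : ℝ) ^ 2)⁻¹ * Poly5.eval r.tauR (Poly5.mulFast V V) y := by
    funext y; rw [hpt]; field_simp
  rw [hfun]
  refine ⟨hI.const_mul _, ?_⟩
  rw [integral_const_mul, hval, ← hDdef, div_eq_inv_mul]

end Summit.NavierStokesRegularity.NavierStokesRegularity.Cruxes.ScarEnvelopeTypeI.ForcedTsai
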